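import Mathlib.Analysis.SpecialFunctions.Pow.Real
import Mathlib.Data.Nat.Factorial.Basic
import Literature.NumberTheory.Transcendental.DiazAsymptotics
import HarnessLib

/-!
# Diaz 1989, Théorème 1 — §II-4-1: the parameters `D, L, M, M₁, ρ` as functions of `X`

Topic `Literature/NumberTheory/Transcendental` (trunk T-TRANSCEND). Decomposition step for the
named fact `Literature.NumberTheory.Transcendental.Diaz1989_thm1` (`DiazMain.lean`): the choice of parameters of
§II-4-1, p. 15, of G. Diaz, J. Number Theory 31 (1989):
`D = [X^{m+n}(log X)^{-n/(n+1)}]`, `L = a₁[X^{m-1}(log X)^{1/(n+1)}]`, `M = [X^{n+1}]`, `M₁ = a₂M`,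
`ρ = c_ρ X^{m(n+1)} log X` (the source has `M₁ = a₂[X^{n+1}]`, `a₁ = 1 + [2^{(mn+m+n+2)/n}]`,
`a₂ = 4(n+1)([a₁^{n/m}]+1)(n+1)!`, `c_ρ = 8(n+1)`; our constants are chosen generously:
`a₁ = 2^{mn+m+n+2}`, `a₂ = 4(n+1)((n+1)! a₁ⁿ + 1)`, `c_ρ = 16(n+1)`), together with the
elementary consequences used by the proof, each as an eventual statement in `X`:

* `two_le_D/L/M` and the sandwiches `D_le`, `half_le_D`, … between the integer parts and the
  scales `Asymp.scale`;
* `eventually_C1` — (𝒞1) `2^{mn+m+1} M^m ≤ D Lⁿ` (Siegel's step);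
* `eventually_C7`, `eventually_C8` — the hypotheses (11) of the zero lemma with `S = M₁ - 1`,
  `D₀ = D - 1`, `D₁ = L - 1`.

Everything here is proved.

## References

* G. Diaz, *Grands degrés de transcendance pour des familles d'exponentielles*, J. Number Theory
  31 (1989), 1–23, §II-4-1, p. 15; constraints (𝒞1) p. 5, (𝒞7), (𝒞8) p. 13.
-/

noncomputable section

open Filter Real Literature.NumberTheory.Transcendental.Asymp

namespace Literature.NumberTheory.Transcendental

namespace DiazThm1

/-- `a₁ = 2^{mn+m+n+2}` (the source: `1 + [2^{(mn+m+n+2)/n}]`). [cite: Diaz1989, §II-4-1 p. 15] -/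
def a1 (m n : ℕ) : ℕ := 2 ^ (m + n * m + n + 2)

/-- `a₂ = 4(n+1)((n+1)! a₁ⁿ + 1)` (the source: `4(n+1)([a₁^{n/m}]+1)(n+1)!`).
[cite: Diaz1989, §II-4-1 p. 15] -/
def a2 (m n : ℕ) : ℕ := 4 * (n + 1) * ((n + 1).factorial * a1 m n ^ n + 1)

/-- `D = [X^{m+n} (log X)^{-n/(n+1)}]`. [cite: Diaz1989, §II-4-1 p. 15] -/
def Dp (m n : ℕ) (X : ℝ) : ℕ := ⌊scale (m + n) (-(n / (n + 1 : ℝ))) X⌋₊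

/-- `L = [a₁ X^{m-1} (log X)^{1/(n+1)}]`. [cite: Diaz1989, §II-4-1 p. 15] -/
def Lp (m n : ℕ) (X : ℝ) : ℕ := ⌊a1 m n * scale (m - 1 : ℕ) (1 / (n + 1 : ℝ)) X⌋₊

/-- `M = [X^{n+1}]`. [cite: Diaz1989, §II-4-1 p. 15] -/
def Mp (n : ℕ) (X : ℝ) : ℕ := ⌊scale (n + 1) 0 X⌋₊

/-- `M₁ = a₂ M`. [cite: Diaz1989, §II-4-1 p. 15] -/
def M1p (m n : ℕ) (X : ℝ) : ℕ := a2 m n * Mp n X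

/-- `ρ = 16(n+1) X^{m(n+1)} log X` (the source: `8(n+1) X^{m(n+1)} log X`).
[cite: Diaz1989, §II-4-1 p. 15] -/
def rho (m n : ℕ) (X : ℝ) : ℝ := 16 * (n + 1) * scale (m * (n + 1)) 1 X

variable {m n : ℕ}

/-- `a₁ ≥ 1`. [folklore] -/
theorem one_le_a1 : 1 ≤ a1 m n := Nat.one_le_two_pow

/-- `a₂ ≥ 1`. [folklore] -/
theorem one_le_a2 : 1 ≤ a2 m n := by
  unfold a2
  have : 1 ≤ (n + 1).factorial * a1 m n ^ n + 1 := Nat.le_add_left _ _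
  nlinarith

/-! ### Sandwiches -/

/-- `D ≤ X^{m+n}(log X)^{-n/(n+1)}` (`X ≥ 1`). [folklore] -/
theorem D_le {X : ℝ} (hX : 1 ≤ X) : (Dp m n X : ℝ) ≤ scale (m + n) (-(n / (n + 1 : ℝ))) X :=
  Nat.floor_le (scale_nonneg hX)

/-- `L ≤ a₁ X^{m-1}(log X)^{1/(n+1)}` (`X ≥ 1`). [folklore] -/
theorem L_le {X : ℝ} (hX : 1 ≤ X) :
    (Lp m n X : ℝ) ≤ a1 m n * scale (m - 1 : ℕ) (1 / (n + 1 : ℝ)) X :=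
  Nat.floor_le (mul_nonneg (Nat.cast_nonneg _) (scale_nonneg hX))

/-- `M ≤ X^{n+1}` (`X ≥ 1`). [folklore] -/
theorem M_le {X : ℝ} (hX : 1 ≤ X) : (Mp n X : ℝ) ≤ scale (n + 1) 0 X :=
  Nat.floor_le (scale_nonneg hX)

/-- Eventually `D ≥ X^{m+n}(log X)^{-n/(n+1)}/2` and `D ≥ 2` (for `m + n > 0`). [folklore] -/
theorem eventually_D_ge (hmn : 0 < m + n) :
    ∀ᶠ X in atTop, scale (m + n) (-(n / (n + 1 : ℝ))) X / 2 ≤ (Dp m n X : ℝ) ∧ 2 ≤ Dp m n X := by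
  have h4 : ∀ᶠ X in atTop, (4 : ℝ) ≤ scale (m + n) (-(n / (n + 1 : ℝ))) X :=
    eventually_const_le_scale (Or.inl (by exact_mod_cast hmn)) 4
  filter_upwards [h4] with X hX
  have hfl := Nat.lt_floor_add_one (scale (m + n) (-(n / (n + 1 : ℝ))) X)
  have h1 : scale (m + n) (-(n / (n + 1 : ℝ))) X / 2 ≤ (Dp m n X : ℝ) := by unfold Dp; linarith
  refine ⟨h1, ?_⟩
  have : (2 : ℝ) ≤ (Dp m n X : ℝ) := by linarith
  exact_mod_cast this

/-- Eventually `L ≥ a₁X^{m-1}(log X)^{1/(n+1)}/2` and `L ≥ 2`. [folklore] -/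
theorem eventually_L_ge :
    ∀ᶠ X in atTop, a1 m n * scale (m - 1 : ℕ) (1 / (n + 1 : ℝ)) X / 2 ≤ (Lp m n X : ℝ) ∧
      2 ≤ Lp m n X := by
  have h4 : ∀ᶠ X in atTop, (4 : ℝ) ≤ a1 m n * scale (m - 1 : ℕ) (1 / (n + 1 : ℝ)) X := by
    have ha : (1 : ℝ) ≤ a1 m n := by exact_mod_cast one_le_a1 (m := m) (n := n)
    have h4' : ∀ᶠ X in atTop, (4 : ℝ) ≤ scale (m - 1 : ℕ) (1 / (n + 1 : ℝ)) X := by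
      rcases Nat.eq_zero_or_pos (m - 1) with h0 | hpos
      · rw [h0]
        exact eventually_const_le_scale (Or.inr ⟨by simp, by positivity⟩) 4
      · exact eventually_const_le_scale (Or.inl (by exact_mod_cast hpos)) 4
    filter_upwards [h4', eventually_ge_atTop (1 : ℝ)] with X hX hX1
    calc (4 : ℝ) ≤ scale (m - 1 : ℕ) (1 / (n + 1 : ℝ)) X := hX
      _ ≤ a1 m n * scale (m - 1 : ℕ) (1 / (n + 1 : ℝ)) X :=
          le_mul_of_one_le_left (scale_nonneg hX1) ha
  filter_upwards [h4] with X hX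
  have hfl := Nat.lt_floor_add_one (a1 m n * scale (m - 1 : ℕ) (1 / (n + 1 : ℝ)) X)
  have h1 : a1 m n * scale (m - 1 : ℕ) (1 / (n + 1 : ℝ)) X / 2 ≤ (Lp m n X : ℝ) := by
    unfold Lp; linarith
  refine ⟨h1, ?_⟩
  have : (2 : ℝ) ≤ (Lp m n X : ℝ) := by linarith
  exact_mod_cast this

/-- Eventually `M ≥ X^{n+1}/2` and `M ≥ 2`. [folklore] -/
theorem eventually_M_ge :
    ∀ᶠ X in atTop, scale (n + 1) 0 X / 2 ≤ (Mp n X : ℝ) ∧ 2 ≤ Mp n X := by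
  have h4 : ∀ᶠ X in atTop, (4 : ℝ) ≤ scale (n + 1) 0 X :=
    eventually_const_le_scale (Or.inl (by positivity)) 4
  filter_upwards [h4] with X hX
  have hfl := Nat.lt_floor_add_one (scale (n + 1) 0 X)
  have h1 : scale (n + 1) 0 X / 2 ≤ (Mp n X : ℝ) := by unfold Mp; linarith
  refine ⟨h1, ?_⟩
  have : (2 : ℝ) ≤ (Mp n X : ℝ) := by linarith
  exact_mod_cast this

/-! ### (𝒞1) -/

/-- `a₁ⁿ ≥ 2^{mn+m+1} · 2^{n+1}` for `n ≥ 1`. [folklore] -/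
theorem pow_le_a1_pow (hn : 1 ≤ n) :
    (2 : ℝ) ^ (m + n * m + 1) * 2 ^ (n + 1) ≤ (a1 m n : ℝ) ^ n := by
  have e : (2 : ℝ) ^ (m + n * m + 1) * 2 ^ (n + 1) = (a1 m n : ℝ) := by
    unfold a1; push_cast; rw [← pow_add]; ring_nf
  rw [e]
  calc (a1 m n : ℝ) = (a1 m n : ℝ) ^ 1 := (pow_one _).symm
    _ ≤ (a1 m n : ℝ) ^ n := pow_le_pow_right₀ (by exact_mod_cast one_le_a1 (m := m) (n := n)) hn

/-- **(𝒞1) eventually**: `2^{mn+m+1} M^m ≤ D Lⁿ` (for `m, n ≥ 1`). [cite: Diaz1989, §II-2 (𝒞1) p. 5] -/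
theorem eventually_C1 (hm : 1 ≤ m) (hn : 1 ≤ n) :
    ∀ᶠ X in atTop, 2 ^ (m + n * m + 1) * Mp n X ^ m ≤ Dp m n X * Lp m n X ^ n := by
  filter_upwards [eventually_D_ge (m := m) (n := n) (by omega), eventually_L_ge (m := m) (n := n),
    eventually_gt_atTop (1 : ℝ)] with X hD hL hX1
  have hsD := scale_nonneg (a := m + n) (b := -(n / (n + 1 : ℝ))) hX1.le
  have hsL := scale_nonneg (a := (m - 1 : ℕ)) (b := 1 / (n + 1 : ℝ)) hX1.le
  have ha1 : (1 : ℝ) ≤ a1 m n := by exact_mod_cast one_le_a1 (m := m) (n := n)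
  -- the scales: `scale(n+1,0)^m = scale(m(n+1), 0) = scale(m+n,-n/(n+1)) * scale(m-1,1/(n+1))^n`
  set Z : ℝ := scale (m * (n + 1)) 0 X with hZ
  have hZ0 : 0 ≤ Z := scale_nonneg hX1.le
  have e1 : scale (n + 1) 0 X ^ m = Z := by
    rw [hZ, scale_pow hX1.le]; congr 1
    · ring
    · simp
  have e2 : scale (m + n) (-(n / (n + 1 : ℝ))) X * scale (m - 1 : ℕ) (1 / (n + 1 : ℝ)) X ^ n = Z := by
    rw [hZ, scale_pow hX1.le, scale_mul_scale hX1]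
    congr 1
    · push_cast [Nat.cast_sub hm]; ring
    · field_simp; ring
  have key : (2 : ℝ) ^ (m + n * m + 1) * (Mp n X : ℝ) ^ m ≤ (Dp m n X : ℝ) * (Lp m n X : ℝ) ^ n := by
    have hMm : (Mp n X : ℝ) ^ m ≤ Z := by
      rw [← e1]; exact pow_le_pow_left₀ (Nat.cast_nonneg _) (M_le (n := n) hX1.le) m
    calc (2 : ℝ) ^ (m + n * m + 1) * (Mp n X : ℝ) ^ m ≤ 2 ^ (m + n * m + 1) * Z :=
          mul_le_mul_of_nonneg_left hMm (by positivity)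
      _ ≤ ((a1 m n : ℝ) ^ n / 2 ^ (n + 1)) * Z := by
          refine mul_le_mul_of_nonneg_right ?_ hZ0
          rw [le_div_iff₀ (by positivity)]
          exact pow_le_a1_pow hn
      _ = (scale (m + n) (-(n / (n + 1 : ℝ))) X / 2) *
            (a1 m n * scale (m - 1 : ℕ) (1 / (n + 1 : ℝ)) X / 2) ^ n := by
          rw [← e2, div_pow, mul_pow, pow_succ]
          ring
      _ ≤ (Dp m n X : ℝ) * (Lp m n X : ℝ) ^ n :=
          mul_le_mul hD.1 (pow_le_pow_left₀ (by positivity) hL.1 n) (by positivity)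
            (Nat.cast_nonneg _)
  exact_mod_cast key

/-! ### (𝒞7), (𝒞8): the hypotheses (11) of the zero lemma -/

/-- The base `b = (n+1)! a₁ⁿ + 1 = a₂/(4(n+1))`. [folklore] -/
theorem a2_eq : (a2 m n : ℝ) = 4 * (n + 1) * ((n + 1).factorial * (a1 m n : ℝ) ^ n + 1) := by
  unfold a2; push_cast; ring

/-- Eventually `(M₁ - 1)/(n+1) ≥ b · X^{n+1}` with `b = (n+1)! a₁ⁿ + 1 = a₂/(4(n+1))`.
[folklore] -/
theorem eventually_M1_sub_one_div_ge :
    ∀ᶠ X in atTop, ((n + 1).factorial * (a1 m n : ℝ) ^ n + 1) * scale (n + 1) 0 X ≤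
      ((M1p m n X - 1 : ℕ) : ℝ) / (n + 1) := by
  filter_upwards [eventually_M_ge (n := n), eventually_gt_atTop (1 : ℝ)] with X hM hX1
  set b : ℝ := (n + 1).factorial * (a1 m n : ℝ) ^ n + 1 with hb
  have hfa : (0 : ℝ) ≤ (n + 1).factorial * (a1 m n : ℝ) ^ n := by positivity
  have hb0 : 0 ≤ b := by rw [hb]; linarith
  have hM2 : (2 : ℝ) ≤ Mp n X := by exact_mod_cast hM.2
  have hM1 : ((M1p m n X - 1 : ℕ) : ℝ) = a2 m n * Mp n X - 1 := by
    have h1 : 1 ≤ M1p m n X := by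
      unfold M1p; exact le_trans one_le_a2 (Nat.le_mul_of_pos_right _ (by omega))
    rw [Nat.cast_sub h1]; unfold M1p; push_cast; ring
  rw [hM1, a2_eq, le_div_iff₀ (by positivity), ← hb]
  have hs : scale (n + 1) 0 X / 2 ≤ (Mp n X : ℝ) := hM.1
  have hs0 : 0 ≤ scale (n + 1) 0 X := scale_nonneg hX1.le
  -- `b s (n+1) ≤ 4(n+1) b M - 1`: from `s ≤ 2M`, `b s (n+1) ≤ 2 (n+1) b M ≤ 4(n+1) b M - 1`
  have h1 : b * scale (n + 1) 0 X * (n + 1) ≤ 2 * (n + 1) * b * Mp n X := by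
    have := mul_le_mul_of_nonneg_left hs (show (0 : ℝ) ≤ 2 * (n + 1) * b by positivity)
    nlinarith
  have h2 : (1 : ℝ) ≤ 2 * (n + 1) * b * Mp n X := by
    have hb1 : 1 ≤ b := by rw [hb]; linarith
    have : (1 : ℝ) ≤ (n + 1) := by
      have : (0 : ℝ) ≤ n := Nat.cast_nonneg n
      linarith
    calc (1 : ℝ) = 1 * 1 * 1 * 1 := by ring
      _ ≤ 2 * (n + 1) * b * Mp n X := by
          refine mul_le_mul (mul_le_mul (mul_le_mul (by norm_num) this zero_le_one (by norm_num)) hb1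
            zero_le_one (by positivity)) (by linarith) zero_le_one (by positivity)
  linarith

/-- **(𝒞7) eventually**: `(n+1)! (D-1)(L-1)ⁿ < ((M₁-1)/(n+1))^m` (for `m, n ≥ 1`).
[cite: Diaz1989, §II-3-4 (𝒞7) p. 13] -/
theorem eventually_C7 (hm : 1 ≤ m) :
    ∀ᶠ X in atTop, ((n + 1).factorial : ℝ) * ((Dp m n X - 1 : ℕ) : ℝ) * ((Lp m n X - 1 : ℕ) : ℝ) ^ n <
      (((M1p m n X - 1 : ℕ) : ℝ) / (n + 1)) ^ m := by
  filter_upwards [eventually_M1_sub_one_div_ge (m := m) (n := n), eventually_gt_atTop (1 : ℝ)]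
    with X hM1 hX1
  set b : ℝ := (n + 1).factorial * (a1 m n : ℝ) ^ n + 1 with hb
  set Z : ℝ := scale (m * (n + 1)) 0 X with hZ
  have hZpos : 0 < Z := scale_pos hX1
  have hfa : (0 : ℝ) ≤ (n + 1).factorial * (a1 m n : ℝ) ^ n := by positivity
  have hb1 : 1 ≤ b := by rw [hb]; linarith
  have hsD := scale_nonneg (a := m + n) (b := -(n / (n + 1 : ℝ))) hX1.le
  have e1 : scale (n + 1) 0 X ^ m = Z := by
    rw [hZ, scale_pow hX1.le]; congr 1
    · ring
    · simp
  have e2 : scale (m + n) (-(n / (n + 1 : ℝ))) X * scale (m - 1 : ℕ) (1 / (n + 1 : ℝ)) X ^ n = Z := by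
    rw [hZ, scale_pow hX1.le, scale_mul_scale hX1]
    congr 1
    · push_cast [Nat.cast_sub hm]; ring
    · field_simp; ring
  -- LHS ≤ (n+1)! a₁ⁿ Z
  have hD' : ((Dp m n X - 1 : ℕ) : ℝ) ≤ scale (m + n) (-(n / (n + 1 : ℝ))) X := by
    calc ((Dp m n X - 1 : ℕ) : ℝ) ≤ Dp m n X := by exact_mod_cast Nat.sub_le _ _
      _ ≤ _ := D_le hX1.le
  have hL' : ((Lp m n X - 1 : ℕ) : ℝ) ≤ a1 m n * scale (m - 1 : ℕ) (1 / (n + 1 : ℝ)) X := by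
    calc ((Lp m n X - 1 : ℕ) : ℝ) ≤ Lp m n X := by exact_mod_cast Nat.sub_le _ _
      _ ≤ _ := L_le hX1.le
  have hLHS : ((n + 1).factorial : ℝ) * ((Dp m n X - 1 : ℕ) : ℝ) * ((Lp m n X - 1 : ℕ) : ℝ) ^ n ≤
      (n + 1).factorial * (a1 m n : ℝ) ^ n * Z := by
    calc ((n + 1).factorial : ℝ) * ((Dp m n X - 1 : ℕ) : ℝ) * ((Lp m n X - 1 : ℕ) : ℝ) ^ n
        ≤ (n + 1).factorial * scale (m + n) (-(n / (n + 1 : ℝ))) X *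
            (a1 m n * scale (m - 1 : ℕ) (1 / (n + 1 : ℝ)) X) ^ n := by
          refine mul_le_mul (mul_le_mul_of_nonneg_left hD' (by positivity))
            (pow_le_pow_left₀ (Nat.cast_nonneg _) hL' n) (by positivity)
            (mul_nonneg (by positivity) hsD)
      _ = (n + 1).factorial * (a1 m n : ℝ) ^ n * Z := by rw [← e2, mul_pow]; ring
  -- RHS ≥ (b s_M)^m = b^m Z ≥ b Z
  have hRHS : b * Z ≤ (((M1p m n X - 1 : ℕ) : ℝ) / (n + 1)) ^ m := by
    calc b * Z ≤ b ^ m * Z := mul_le_mul_of_nonneg_right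
          (by calc b = b ^ 1 := (pow_one b).symm
                _ ≤ b ^ m := pow_le_pow_right₀ hb1 hm) hZpos.le
      _ = (b * scale (n + 1) 0 X) ^ m := by rw [mul_pow, e1]
      _ ≤ (((M1p m n X - 1 : ℕ) : ℝ) / (n + 1)) ^ m :=
          pow_le_pow_left₀ (mul_nonneg (by linarith) (scale_nonneg hX1.le)) hM1 m
  calc ((n + 1).factorial : ℝ) * ((Dp m n X - 1 : ℕ) : ℝ) * ((Lp m n X - 1 : ℕ) : ℝ) ^ n
      ≤ (n + 1).factorial * (a1 m n : ℝ) ^ n * Z := hLHS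
    _ < b * Z := by
        refine mul_lt_mul_of_pos_right ?_ hZpos
        rw [hb]; linarith
    _ ≤ _ := hRHS

/-- **(𝒞8) eventually**: `(n+1)(L-1) < ((M₁-1)/(n+1))^{m-1}` (for `m ≥ 2`, `n ≥ 1`).
[cite: Diaz1989, §II-3-4 (𝒞8) p. 13] -/
theorem eventually_C8 (hm : 2 ≤ m) (hn : 1 ≤ n) :
    ∀ᶠ X in atTop, (n + 1 : ℝ) * ((Lp m n X - 1 : ℕ) : ℝ) <
      (((M1p m n X - 1 : ℕ) : ℝ) / (n + 1)) ^ (m - 1) := by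
  have hlt : ((m - 1 : ℕ) : ℝ) < ((n + 1) * (m - 1 : ℕ) : ℝ) := by
    have h1 : (1 : ℝ) ≤ ((m - 1 : ℕ) : ℝ) := by exact_mod_cast (show 1 ≤ m - 1 by omega)
    have h2 : (1 : ℝ) ≤ n := by exact_mod_cast hn
    nlinarith
  filter_upwards [eventually_M1_sub_one_div_ge (m := m) (n := n), eventually_gt_atTop (1 : ℝ),
    eventually_mul_scale_le_of_lt hlt (1 / (n + 1 : ℝ)) 0 (2 * (n + 1) * a1 m n)] with X hM1 hX1 hdom
  set b : ℝ := (n + 1).factorial * (a1 m n : ℝ) ^ n + 1 with hb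
  have hfa : (0 : ℝ) ≤ (n + 1).factorial * (a1 m n : ℝ) ^ n := by positivity
  have hb1 : 1 ≤ b := by rw [hb]; linarith
  have hL' : ((Lp m n X - 1 : ℕ) : ℝ) ≤ a1 m n * scale (m - 1 : ℕ) (1 / (n + 1 : ℝ)) X := by
    calc ((Lp m n X - 1 : ℕ) : ℝ) ≤ Lp m n X := by exact_mod_cast Nat.sub_le _ _
      _ ≤ _ := L_le hX1.le
  have hs0 : 0 < scale ((n + 1) * (m - 1 : ℕ)) 0 X := scale_pos hX1
  -- RHS ≥ (b s_M)^{m-1} ≥ s_M^{m-1} = scale((n+1)(m-1), 0)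
  have hRHS : scale ((n + 1) * (m - 1 : ℕ)) 0 X ≤ (((M1p m n X - 1 : ℕ) : ℝ) / (n + 1)) ^ (m - 1) := by
    calc scale ((n + 1) * (m - 1 : ℕ)) 0 X = scale (n + 1) 0 X ^ (m - 1) := by
          rw [scale_pow hX1.le]; congr 1; simp
      _ ≤ (b * scale (n + 1) 0 X) ^ (m - 1) :=
          pow_le_pow_left₀ (scale_nonneg hX1.le)
            (le_mul_of_one_le_left (scale_nonneg hX1.le) hb1) _
      _ ≤ _ := pow_le_pow_left₀ (mul_nonneg (by linarith) (scale_nonneg hX1.le)) hM1 _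
  calc (n + 1 : ℝ) * ((Lp m n X - 1 : ℕ) : ℝ) ≤ (n + 1) * (a1 m n * scale (m - 1 : ℕ) (1 / (n + 1 : ℝ)) X) :=
        mul_le_mul_of_nonneg_left hL' (by positivity)
    _ = (2 * (n + 1) * a1 m n) * scale (m - 1 : ℕ) (1 / (n + 1 : ℝ)) X / 2 := by ring
    _ ≤ scale ((n + 1) * (m - 1 : ℕ)) 0 X / 2 := by linarith
    _ < scale ((n + 1) * (m - 1 : ℕ)) 0 X := by linarith
    _ ≤ _ := hRHS

end DiazThm1


end Literature.NumberTheory.Transcendental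

end
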